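import Mathlib
import Literature.Computability.AlgebraicComplexity.NewtonPolygonTau

/-!
# Sketch — crux-ideate `stmt-ValiantsHypothesis-5907` (`NewtonUnitEquations.DissociatedFixedK`),
ideator 1, round 1

First lemmas of the two idea cards filed by this seat, stated over existing declarations
(Mathlib + `Literature.Computability.AlgebraicComplexity.newtonVertexCount`).

* Line B `slice-contraction-descent`: `topSurvivor_contract` — **proved here, sorry-free** — the
  Strassen-substitution / slice-contraction step on the coefficient tensor: killing one product
  through one coordinate turns the `w`-top survivor `b` of a `k`-term tensor on `m+1` coordinates
  into the `w`-top survivor `b ∘ j.succAbove` of a `(k-1)`-term tensor on `m` coordinates.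
  `descent_inequality` records the polynomial-level recursion it feeds (statement only).
* Line A `matching-functional-thickness`: `cube_lemma` and `thickness` (statements only; the
  matching-functional proof is on the card).
* Shared counting lemma of both lines: `card_argmaxTuples_le` (planar sweep; statement only).
-/

set_option linter.dupNamespace false

namespace Summit.ValiantsHypothesis.ValiantsHypothesis.Cruxes.DissociatedFixedK.IdeatorOne

open Finset

section Tensor

variable {X : Type*}

/-- Coefficient tensor of the weighted sum of products `Σ_i λ_i Π_j f_ij` on a frame:
`T(a) = Σ_i λ_i Π_j c_ij(a_j)` (with `c_ij(y) = coeff y (f i j)`). -/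
def tensorOf {k m : ℕ} (lam : Fin k → ℂ) (c : Fin k → Fin m → X → ℂ) (a : Fin m → X) : ℂ :=
  ∑ i, lam i * ∏ j, c i j (a j)

/-- Weights of the contraction killing product `i0` through coordinate `j` at the two heights
`y` (upper) and `y'` (lower): `λ'_i = λ_i · (c_ij(y) c_{i0 j}(y') - c_ij(y') c_{i0 j}(y))`. -/
def contractWeights {k m : ℕ} (lam : Fin k → ℂ) (c : Fin k → Fin (m + 1) → X → ℂ)
    (i0 : Fin k) (j : Fin (m + 1)) (y y' : X) : Fin k → ℂ :=
  fun i => lam i * (c i j y * c i0 j y' - c i j y' * c i0 j y)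

/-- The killed product has weight `0`: the contraction has at most `k - 1` live terms. -/
theorem contractWeights_self {k m : ℕ} (lam : Fin k → ℂ) (c : Fin k → Fin (m + 1) → X → ℂ)
    (i0 : Fin k) (j : Fin (m + 1)) (y y' : X) : contractWeights lam c i0 j y y' i0 = 0 := by
  simp [contractWeights, mul_comm]

/-- The contracted tensor is the corresponding combination of the two `j`-slices. -/
theorem tensorOf_contract {k m : ℕ} (lam : Fin k → ℂ) (c : Fin k → Fin (m + 1) → X → ℂ)
    (i0 : Fin k) (j : Fin (m + 1)) (y y' : X) (a' : Fin m → X) :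
    tensorOf (contractWeights lam c i0 j y y') (fun i l => c i (j.succAbove l)) a' =
      c i0 j y' * tensorOf lam c (Fin.insertNth (α := fun _ => X) j y a') -
        c i0 j y * tensorOf lam c (Fin.insertNth (α := fun _ => X) j y' a') := by
  simp only [tensorOf, contractWeights]
  rw [Finset.mul_sum, Finset.mul_sum, ← Finset.sum_sub_distrib]
  refine Finset.sum_congr rfl fun i _ => ?_
  rw [Fin.prod_univ_succAbove (fun j' => c i j' (Fin.insertNth (α := fun _ => X) j y a' j')) j,
    Fin.prod_univ_succAbove (fun j' => c i j' (Fin.insertNth (α := fun _ => X) j y' a' j')) j]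
  simp only [Fin.insertNth_apply_same, Fin.insertNth_apply_succAbove]
  ring

/-- **Line B, first lemma — top-survivor descent under slice contraction (proved).**
Let `T = Σ_i λ_i ⊗_j c_ij` on the frame `Π_j A_j` (`m+1` coordinates), heights `h_j : X → ℝ`
(in the application `h_j = w ∘ ι` for a linear functional `w` on `ℝ²`), and let `b` be a
*top survivor*: `T b ≠ 0` and `T a = 0` for every other frame point `a` of total height `≥` that
of `b` (this is what "σ(b) is a `w`-exposed vertex of the Newton polygon" means under
dissociation). If some product `i0` has a support height `y ∈ A_j` with `c_{i0 j}(y) ≠ 0` STRICTLY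
above `b_j`, then for the contraction `λ'` (which kills `i0`, `contractWeights_self`) the punctured
tuple `b ∘ j.succAbove` is again a top survivor, of a tensor with `≤ k-1` live terms on `m`
coordinates. No genericity, no aliveness pattern, no cube. -/
theorem topSurvivor_contract {k m : ℕ} (A : Fin (m + 1) → Finset X) (h : Fin (m + 1) → X → ℝ)
    (lam : Fin k → ℂ) (c : Fin k → Fin (m + 1) → X → ℂ) (b : Fin (m + 1) → X)
    (hb : ∀ j, b j ∈ A j)
    (htop : ∀ a : Fin (m + 1) → X, (∀ j, a j ∈ A j) → a ≠ b →
      ∑ j, h j (b j) ≤ ∑ j, h j (a j) → tensorOf lam c a = 0)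
    (hTb : tensorOf lam c b ≠ 0)
    (i0 : Fin k) (j : Fin (m + 1)) (y : X) (hy : y ∈ A j) (hyc : c i0 j y ≠ 0)
    (hyh : h j (b j) < h j y) :
    tensorOf (contractWeights lam c i0 j y (b j)) (fun i l => c i (j.succAbove l))
        (fun l => b (j.succAbove l)) ≠ 0 ∧
      ∀ a' : Fin m → X, (∀ l, a' l ∈ A (j.succAbove l)) → a' ≠ (fun l => b (j.succAbove l)) →
        ∑ l, h (j.succAbove l) (b (j.succAbove l)) ≤ ∑ l, h (j.succAbove l) (a' l) →
        tensorOf (contractWeights lam c i0 j y (b j)) (fun i l => c i (j.succAbove l)) a' = 0 := by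
  have hyne : y ≠ b j := by
    intro e
    rw [e] at hyh
    exact lt_irrefl _ hyh
  have mem_ins : ∀ (z : X) (a' : Fin m → X), z ∈ A j → (∀ l, a' l ∈ A (j.succAbove l)) →
      ∀ j', Fin.insertNth (α := fun _ => X) j z a' j' ∈ A j' := by
    intro z a' hz ha'
    refine (Fin.forall_iff_succAbove j).2 ⟨?_, fun l => ?_⟩
    · simpa using hz
    · simpa using ha' l
  have sum_ins : ∀ (z : X) (a' : Fin m → X),
      ∑ j', h j' (Fin.insertNth (α := fun _ => X) j z a' j') =
        h j z + ∑ l, h (j.succAbove l) (a' l) := by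
    intro z a'
    rw [Fin.sum_univ_succAbove _ j]
    simp
  have sum_b : ∑ j', h j' (b j') = h j (b j) + ∑ l, h (j.succAbove l) (b (j.succAbove l)) :=
    Fin.sum_univ_succAbove _ j
  have ins_y_ne : ∀ a' : Fin m → X, Fin.insertNth (α := fun _ => X) j y a' ≠ b := by
    intro a' e
    have := congrFun e j
    simp only [Fin.insertNth_apply_same] at this
    exact hyne this
  refine ⟨?_, ?_⟩
  · rw [tensorOf_contract]
    have h1 : tensorOf lam c (Fin.insertNth (α := fun _ => X) j y fun l => b (j.succAbove l)) = 0 := by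
      refine htop _ (mem_ins y _ hy fun l => hb _) (ins_y_ne _) ?_
      rw [sum_ins, sum_b]
      linarith
    have h2 : Fin.insertNth (α := fun _ => X) j (b j) (fun l => b (j.succAbove l)) = b :=
      Fin.insertNth_self_removeNth j b
    rw [h1, h2, mul_zero, zero_sub, neg_ne_zero]
    exact mul_ne_zero hyc hTb
  · intro a' ha' hne hle
    rw [tensorOf_contract]
    have e1 : tensorOf lam c (Fin.insertNth (α := fun _ => X) j y a') = 0 := by
      refine htop _ (mem_ins y a' hy ha') (ins_y_ne _) ?_
      rw [sum_ins, sum_b]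
      linarith
    have e2 : tensorOf lam c (Fin.insertNth (α := fun _ => X) j (b j) a') = 0 := by
      refine htop _ (mem_ins (b j) a' (hb j) ha') ?_ ?_
      · intro e
        apply hne
        funext l
        have := congrFun e (j.succAbove l)
        simpa using this
      · rw [sum_ins, sum_b]
        linarith
    rw [e1, e2, mul_zero, mul_zero, sub_zero]

/-- **Line A, first lemma — the cube lemma** (Strassen substitution / maximal-matching dual
functional): on the Boolean cube `{0,1}^s`, the corner delta `c·y₁⋯y_s` (`c ≠ 0`) is not a sum of
`≤ s` products of univariate affine functions that all take the value `1` at the origin.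
(Statement only; both paper proofs are on the card.) -/
theorem cube_lemma {s r : ℕ} (cst : ℂ) (hc : cst ≠ 0) (x : Fin r → ℂ) (u : Fin r → Fin s → ℂ)
    (hId : ∀ ε : Fin s → Bool,
      (if ∀ j, ε j = true then cst else 0) =
        ∑ i, x i * ∏ j, (if ε j = true then 1 + u i j else 1)) :
    s + 1 ≤ r := by
  sorry

/-- **Line A — thickness** (radius `k-1` around the alive-pattern top). With `b` a top survivor,
`I` its alive pattern and `aI` the coordinatewise top of the `I`-alive frame (heights injective on
each `A_j`), `b` differs from `aI` in at most `k-1` coordinates. (Statement only.) -/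
theorem thickness [DecidableEq X] {k m : ℕ} (A : Fin m → Finset X) (h : Fin m → X → ℝ)
    (hinj : ∀ j, Set.InjOn (h j) (A j))
    (lam : Fin k → ℂ) (c : Fin k → Fin m → X → ℂ) (b : Fin m → X) (hb : ∀ j, b j ∈ A j)
    (htop : ∀ a : Fin m → X, (∀ j, a j ∈ A j) → a ≠ b →
      ∑ j, h j (b j) ≤ ∑ j, h j (a j) → tensorOf lam c a = 0)
    (hTb : tensorOf lam c b ≠ 0) (aI : Fin m → X)
    (haI : ∀ j, aI j ∈ A j ∧ (∀ i, lam i * ∏ j', c i j' (b j') ≠ 0 → c i j (aI j) ≠ 0) ∧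
      ∀ y ∈ A j, (∀ i, lam i * ∏ j', c i j' (b j') ≠ 0 → c i j y ≠ 0) → h j y ≤ h j (aI j)) :
    (Finset.univ.filter fun j => b j ≠ aI j).card + 1 ≤ k := by
  sorry

end Tensor

/-- **Shared counting lemma (planar sweep).** As `w` ranges over the linear functionals on `ℝ²`
that strictly order every `A_j`, the tuple of `w`-maximisers takes at most `2 Σ_j |A_j|² + 4`
values (charts `w ∝ (±1, λ)`, `λ` off the finitely many tie values, plus `w ∝ (0, ±1)`).
(Statement only.) -/
theorem card_argmaxTuples_le {m : ℕ} (A : Fin m → Finset (Fin 2 → ℝ)) :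
    {a : Fin m → (Fin 2 → ℝ) | ∃ w : (Fin 2 → ℝ) →ₗ[ℝ] ℝ, (∀ j, Set.InjOn w (A j : Set (Fin 2 → ℝ))) ∧
        ∀ j, a j ∈ A j ∧ ∀ y ∈ A j, w y ≤ w (a j)}.ncard ≤ 2 * ∑ j, (A j).card ^ 2 + 4 := by
  sorry

open MvPolynomial Literature.Computability.AlgebraicComplexity in
/-- **Line B — the descent inequality it feeds** (polynomial level; `m+1` coordinates,
weighted products; statement only). Every vertex of `Newt(Σ_i λ_i Π_j f_ij)` is either a vertex
word of the full frame in some generic direction (`≤ 2(m+1)t² + 4` of them) or the lift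
`q + ι(y')` of a vertex `q` of one of the `k(m+1)t²` contractions. -/
theorem descent_inequality {k m t : ℕ} (A : Fin (m + 1) → Finset (Fin 2 →₀ ℕ))
    (lam : Fin k → ℂ) (f : Fin k → Fin (m + 1) → MvPolynomial (Fin 2) ℂ)
    (hA : ∀ j, (A j).card ≤ t) (hf : ∀ i j, (f i j).support ⊆ A j)
    (hdis : ∀ a b : Fin (m + 1) → (Fin 2 →₀ ℕ), (∀ j, a j ∈ A j) → (∀ j, b j ∈ A j) →
      ∑ j, a j = ∑ j, b j → a = b) :
    newtonVertexCount (∑ i, C (lam i) * ∏ j, f i j) ≤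
      (2 * (m + 1) * t ^ 2 + 4) +
        ∑ i0 : Fin k, ∑ j : Fin (m + 1), ∑ y ∈ A j, ∑ y' ∈ A j,
          newtonVertexCount (∑ i, C (lam i * (coeff y (f i j) * coeff y' (f i0 j) -
            coeff y' (f i j) * coeff y (f i0 j))) * ∏ l : Fin m, f i (j.succAbove l)) := by
  sorry

end Summit.ValiantsHypothesis.ValiantsHypothesis.Cruxes.DissociatedFixedK.IdeatorOne
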